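import Literature.NumberTheory.EllipticCurves.KellerYin2024.AnomalousLambdaInvariants
import Literature.NumberTheory.EllipticCurves.Skinner2016.HidaCongruentMembers
import Literature.NumberTheory.EllipticCurves.BDPAnticyclotomicPAdicLFunctionSigmaInt
import Literature.NumberTheory.EllipticCurves.SigmaEulerData
import HarnessLib

/-!
# Keller–Yin Thm. 2.2.2 (`anacong`) / Castella–Grossi–Lee–Skinner Thms. 2.2.1–2.2.2 AT WEIGHT `k = 2r`:
# `μ = 0` and the `λ`-count of the (Σ-imprimitive) BDP `p`-adic `L`-function of an EISENSTEIN-CONGRUENT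
# `p`-ORDINARY NEWFORM OF LEVEL PRIME TO `p` — here the crystalline Hida member `g ∈ S_k(Γ₀(N/p))` of an
# elliptic curve `E/ℚ` at a multiplicative Eisenstein prime `p ∥ N` — typed as named statements

Cell `bsd-eis` (home `run/shared/lean/pub/bsd-eis/`), width seat `bsd-line-x2-p2` g13, for crux 4
`BSDpOnCellC` (stmt-BirchSwinnertonDyer-19034), line «crystal» (LEAD `cruxlead-19034`), registered stub
`stub_memberInvariants` = (i) «`μ(𝓛^Σ_𝔭(g₁)) = 0`» ∧ (ii′) «the `λ`-count at the member» (the LEAD's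
`Cruxes/BSDpOnCellC/STUB-PLAN-memberInvariants.md` §1 asks for exactly this typing). The weight-`2`
sibling is `AnomalousLambdaInvariants.lean` (`thm222_anacong_goodLattice_{of_ne_one,OPEN,of_five_le}`:
the SAME theorem for the curve's own newform at a GOOD prime); this file is its weight-`k` twin for the
MEMBER, in the same currency «(β)» = first unit coefficient (no measure congruence is typed; each frame
carries its own period binders). Nothing is proved about any curve or form; the three named statements
are HYPOTHESES BY NAME (D-0014), two of them preprint-tagged (`_OPEN`, [claim: KellerYin2024]); the
third, `…_of_ne_one` (§3), is the `φ ≠ 𝟙` slice as a COMPOSITION OF REFEREED PRINT (its label —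
«composed print, filer's reading» vs PUB — is the referee's / director's, cf. the weight-`2`
`_of_five_le` and ruling (318)(1); the riders are written out below so that it can be audited line by line).

## Sources, verbatim (held texts: `paper:arxiv-2402.12781` = [KY24] v2; `paper:arxiv-2008.02571` = [CGLS];
## `paper:arxiv-1512.05032` = [Kri16])

* **[KY24] §2 standing** (p0018 L1–L5): "Let `f ∈ S_k(Γ₀(N))` with `k = 2r` be a newform, `p ∤ 2N` and
  `K` an imaginary quadratic field satisfying the Heegner hypothesis. … we assume `p = v v̄` is split in
  `K`. We further assume that the discriminant `D_K` of `K` is odd and `D_K ≠ −3`. … In this section, we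
  continue to study the case `ρ̄_f^{ss} = 𝔽(φ) ⊕ 𝔽(ψ)`. Note that the cases when `φ|_{G_p} = 𝟙` (resp.
  `ω`) but `φ|_{G_K} ≠ 𝟙` (resp. `ω`) are already studied in [CGLS]."
* **[KY24] Prop. 2.1.1** (weight-`k` BDP interpolation, L14–L20): "There exists an element `𝓛_f ∈ Λ^{ur}`
  characterized by …: `𝓛_f(χ̂) = Ω_p^{4n}/Ω_K^{4n} · 4Γ(n+k/2)Γ(n−k/2+1)·…·(1 − a_p(f)p^{−r}χ(𝔭) +
  χ(𝔭²)p^{−1})² · L(f/K, χ, k/2)`" — "This is proved in [CGLS], using results from [CastellaHsieh]. We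
  remark here that the assumption `p ∤ (2k−1)!` can be directly removed from op. cit." = the constants of
  the tree's `bdpInterpolationValueWt` / `IsBDPLFunctionWtSigmaInt` (D3; Castella–Hsieh Prop. 3.8).
* **[KY24] Thm. 2.1.3** (weight-`k` Katz line, L42–L50): "There exists an element `𝓛_θ ∈ Λ^{ur}` …
  `𝓛_θ(χ) = Ω_p^{2n}/Ω_∞^{2n} · 4Γ(n + k/2) · (2πi)^{n−k/2}/√D_K^{n−k/2} · (1 − θ^{−1}(p)χ^{−1}(v)) ·
  (1 − θ(p)χ(v̄)p^{−1}) × ∏_{ℓ∣C}(1 − θ(ℓ)χ(w)ℓ^{−1}) · L(θ_K χ 𝐍_K^{k/2}, 0)`. Proof. See [Kri16]. … the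
  weight in [Kri16] is `k` while the weight in [CGLS] is `2`".
* **[KY24] Thm. 2.2.1** (L59–L63): "`𝓛_f ≡ (𝓔^ι_{φ,ψ})² · (𝓛_φ)² (mod pΛ^{ur})`. Proof. See [CGLS]. Note
  that when `φ|_{G_K} ≠ 𝟙`, we always have full Eisenstein descent by [Kri16]. If `φ|_{G_K} = 𝟙`, we would
  only get partial Eisenstein descent in some cases. However, the proof in [CGLS] essentially only requires
  partial Eisenstein descent because only the constant term of `G` … can be different and the `p`-depletion
  of `G` does not see the constant term."
* **[KY24] Thm. 2.2.2** (`anacong`, L84–L86): "Assume that `ρ̄_f^{ss} = 𝔽(φ) ⊕ 𝔽(ψ)` as `G_ℚ`-modules, with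
  the characters `φ`, `ψ` labeled so that `p ∤ cond(φ)`. Then `μ(𝓛_f) = 0` and
  `λ(𝓛_f) = λ(𝓛_φ) + λ(𝓛_ψ) + Σ_{w∈S}{λ(𝒫_w(φ)) + λ(𝒫_w(ψ)) − λ(𝒫_w(f))}`" ("Combining the above
  inputs, as in [CGLS]").
* **[CGLS] Thm. 2.2.1** (`thm:kriz`, Invent. Math. 227 (2022); p0012 L18–L99) and **Thm. 2.2.2**
  (`cor:Kriz`, L102–L121) — the weight-`2` originals with their PROOF: (eq:cong-mf) `f ≡ G (mod p)`
  [Kri16]; (2.13) the Eisenstein functional `𝓛_G`; (eq:kriz-prop37) its values = [Kri16] Prop. 37;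
  (eq:cor-37) `𝓛_G ≡ 𝓔^ι_{φ,ψ} · 𝓛_φ (mod pΛ^{ur})` "comparing with the interpolation property of `𝓛_φ`";
  (eq:cor-meas) "`θ^m f(x_𝔞) ≡ θ^m G(x_𝔞)` for all `m ≥ 0`, which in turn yield the congruence
  `𝓛_E ≡ (𝓛_G)² (mod pΛ^{ur})`"; Thm. 2.2.2: "`μ(𝓛_E) = 0` follows immediately from the congruence of
  Theorem 2.2.1 and Hida's result [Hida 2010]", `λ((𝓔^ι)²) = Σ_w …` "where `w` runs over all divisors",
  (eq:Euler-comp) "Using the congruence relations in Theorem 2.2.1 (in particular `a_ℓ ≡ 0` for `ℓ ∣ N₀`)".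
* **[Kri16]** (Algebra Number Theory 10 (2016)): Assumptions 1 (p0008 L25–L33: "`f ∈ S_k(Γ₀(N), ε_f)` a
  normalized newform of weight `k ≥ 2` and level `N > 4`; `p ∤ N`; `K` imaginary quadratic with odd
  `D_K < −4` and `p` split; (Heegner)"); **Thm. 3** (Main Theorem, L41–L50: "Suppose `f` has Eisenstein
  descent of type `(ψ₁,ψ₂,N₊,N₋,N₀)` mod `𝔪` … For all `χ ∈ Σ̂_cc(𝔑)` … `𝓛_p(f,χ) ≡ ψ₁^{−1}(D_K)·(… · Ξ ·
  L_p(ψ_{1/K}χ^{−1},0))² mod 𝔪`"), its PROOF §4.3 (p0027 L39–: "Suppose … `f` has PARTIAL Eisenstein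
  descent … `θ^j f ≡ θ^j E_k` … Moreover `θ^j f^♭ ≡ θ^j E_k^♭`", q-expansion principle, Prop. 37,
  "extends by `p`-adic continuity"); **Def. 31** (partial / full Eisenstein descent, p0020); **Rem. 33**
  (p0020 L71–p0021: "If `ψ₁` is non-trivial, then … (5) holds" = FULL descent; for `ψ₁ = ψ₂ = 1`,
  `N₋N₀ = 1` full descent needs θ-injectivity mod `λ`, i.e. `p > k + 1` [Serre]); **Thm. 34** (p0021
  L27–p0022: (1) `ρ̄_f` reducible ⟹ `ρ̄_f ≅ k_λ(ψ̃₁) ⊕ k_λ(ψ̃₂ω^{k−1})`, `ψ₁ψ₂ = ε_f`; (2) the congruences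
  `a_ℓ ≡ ψ₁(ℓ)` / `a_ℓ ≡ ψ₂(ℓ)ℓ^{k−1}` at `ℓ ∥ N`; (3) `ρ̄_f` reducible ⟺ partial Eisenstein descent of
  type `(ψ₁,ψ₂,N₊,N₋,N₀)`); **Prop. 37** (p0027 L19–L27, "Let `k ≥ 2` be an integer …" — the weight-`k`
  Eisenstein values `(Ω_p/Ω_∞)^{k+2j}·t^kΓ(k+j)ψ₁^{−1}(−√D_K)χ^{−1}(𝔱̄)/((2πi)^{k+j}𝔤(ψ₂^{−1})√D_K^j) ·
  Ξ_χ · L(ψ_{1/K}χ^{−1},0)`); **Thm. 27** (Katz, p0018).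
* **[Hida2010MuInvariant]** (tree fact `Hida2010MuInvariant.thmI_mu_katzLFunction_eq_zero`): `μ = 0` of the
  anticyclotomic Katz `p`-adic `L`-function of a character whose conductor is a product of split primes.
* **[KellerYin2024] Lemma 1.1.1** = the tree's `charLocalLambda` (`AnticyclotomicLocalEulerFactors.lean`):
  `λ(𝒫_w(θ)) = [Γ : Γ_w] · 𝟙[θ unramified at w ∧ θ(Frob_w) ≡ Nw (mod 𝔭)]`.

## The object: the crystalline member (dictionary; every binder is tree vocabulary, nothing re-declared)

* `E/ℚ` ↦ a globally minimal `W` (`[W.IsElliptic] [W.IsGloballyMinimal]`) of conductor `N =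
  W.conductorNorm ℤ`; `p` an ODD prime of MULTIPLICATIVE reduction (`2 < p`,
  `W.HasMultiplicativeReductionAtPrime p`: `p ∥ N`, so `M := N/p` is prime to `p`) at which `E[p]` is
  REDUCIBLE (`Rank1Residual.Red W p`; in §§2–3 witnessed by a rational `p`-line `Φ`, `IsRationalLine`).
* `f` of [KY24] §2 ↦ THE MEMBER `g := D.g`, `D : Skinner2016.HidaCongruentForm W p 1`
  (`HidaCongruentMembers.lean`, Skinner 2016 §2.6/§3.1 (a)): a NEWFORM `g ∈ S_k(Γ₀(N/p))` of weight
  `k = D.k > 2`, `(p − 1) ∣ k − 2` (so `k = 2r` is even), `ι`-ORDINARY (`‖ι(a_p(g))‖ = 1` for the member's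
  embedding `D.ι : K_g → ℚ̄_p`), with `‖ι(a_ℓ(g)) − a_ℓ(E)‖_p ≤ p^{−1}` for every prime `ℓ ∤ N`; read in `ℂ`
  through `ι' : ℚ̄_p ≃ ℂ` extending `D.ι` (`∀ x, ι' (D.ι x) = x`). So `g` is a `p`-ordinary newform of
  even weight and level `M` prime to `p` — [KY24] §2's standing for `f := g` — and (rider (BN) below)
  `ρ̄_{g,ι}^{ss} ≅ E[p]^{ss} = 𝔽(φ) ⊕ 𝔽(ψ)` is REDUCIBLE: [KY24] Thm. 2.2.2's hypothesis.
* `K` ↦ an imaginary quadratic field with (Heeg) for `N` (`SatisfiesHeegnerHypothesis N K`: every prime of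
  `N` splits — in particular `p` splits, `((p).primesOver (𝓞 K)).ncard = 2`, and (Heeg) holds for `M`),
  `D_K` odd and `D_K < −4` ([Kri16] Assumptions 1; implies [KY24]'s `D_K ≠ −3`); `𝔭 ∣ p` the prime with
  `k ∈ 𝔭 ↔ ‖ι'^{−1}(w(k))‖ < 1` ("`v` induced by `ι_p`"), in §§2–3 of degree one with its conjugate `𝔭bar`;
  `κ` the anticyclotomic `ℤ_p`-extension, `γ` a topological generator (`T = γ − 1`).
* `𝓛_f` ↦ EVERY Σ-imprimitive weight-`k` frame `Qg ∈ 𝓞_{ℂ_p}⟦T⟧` of `g`: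
  `IsBDPLFunctionWtSigmaInt ι' 𝔭 κ γ D.g (W.sigmaPlacesFinset p K) ΩK' Ωp' Qg` with `ΩK' ≠ 0`, `‖Ωp'‖ = 1`
  (`BDPAnticyclotomicPAdicLFunctionSigmaInt.lean`: interpolation of the Σ-DEPLETED central values
  `L^Σ(g/K, χ, k/2)` with [KY24] Prop. 2.1.1's constants, `Σ = Σ(W,p)(K) = {w : N ∈ w, p ∉ w}` = the places
  of `K` dividing `M`, `SigmaEulerData.lean` §4) — i.e. `𝓛^Σ_𝔭(g) = 𝓛_𝔭(g) · ∏_{w∈Σ} 𝒫_w(g)` ([JSW17]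
  §5.1), the object the crux's line «crystal» holds; "`μ = 0`, `λ = n`" ↦ "first unit coefficient at `n`":
  `‖[Tⁿ]Qg‖ = 1 ∧ ∀ i < n, ‖[Tⁱ]Qg‖ < 1` (the inline shape of `X2.CpIntSeries`, Washington §7.1).
* `(φ, ψ)` ↦ the Teichmüller pair `(θsub, θquot)` of `E[p]` on a rational `p`-line `Φ`
  (`IsTeichmullerLiftOn ∅ Φ θsub`, `IsTeichmullerLiftOnQuot ∅ Φ E[p] θquot`, `LatticeCharacters.lean`;
  `𝒪 = padicCoeffIntegers ∅ ≅ ℤ_p`), `{φ, ψ} = {θsub, θquot}` with `φ` THE MEMBER UNRAMIFIED AT `p`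
  ("labeled so that `p ∤ cond(φ)`"; at a multiplicative `p` exactly one member is, tree theorem
  `TeichmullerPairUnramifiedAtMult`); `𝓛_φ` ↦ every Katz frame `Lφ` of the Hecke character `θK` of `φ|_{G_K}`
  (`IsHeckeCharOf ι' (φ.restrictField K) θK`, arithmetic convention) with ramified set `Cbar` and its own
  periods: `IsKatzLFunction ι' 𝔭 𝔭bar Cbar κ γ θK ΩK″ Ωp″ Lφ` (`KatzPAdicLFunctionFrame.lean` = [CGLS]
  Thm. 2.1.2, the WEIGHT-2 anticyclotomic Katz line — rider (d′)); `λ(𝓛_φ) = nφ` ↦ `FirstUnitCoeffAt Lφ nφ`.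
* `λ(𝒫_w(θ))` ↦ `charLocalLambda ∅ κ (θ.restrictField K) w`; the printed `λ(𝓛_φ) + λ(𝓛_ψ)` ↦ `2·nφ`:
  [KY24]/[CGLS] Thm. 2.2.1 gives `(𝓛_φ)²` DIRECTLY (the printed `λ(𝓛_ψ)` is cosmetic, via the functional
  equation (2.16); no Katz frame for the `p`-RAMIFIED `ψ` is needed or typed — as in the weight-`2` sibling).

## The printed argument at weight `k`, and the riders (what a referee must check; nothing hidden)

For `f := g` as above: (BN) `tr ρ_{g,ι}(Frob_ℓ) = a_ℓ(g) ≡ a_ℓ(E) = tr ρ_{E,p}(Frob_ℓ)` and `det =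
ℓ^{k−1} ≡ ℓ (mod p)` (`(p−1) ∣ k−2`) for all `ℓ ∤ N = Mp` ⟹ (Chebotarev, Brauer–Nesbitt) `ρ̄_g^{ss} ≅
E[p]^{ss} = 𝔽(φ) ⊕ 𝔽(ψ)`, `φψ = ω`, `φ` unramified at `p` — the hypothesis of [KY24] Thm. 2.2.2 / [Kri16]
Thm. 34; (K34) [Kri16] Thm. 34 (1)–(3) at weight `k`: `g` has PARTIAL Eisenstein descent of type
`(φ, φ^{−1}, M₊, M₋, M₀)` mod `λ` (`ψ₁ψ₂ = ε_g = 1`, `ψ₂ω^{k−1} = φ^{−1}ω = ψ`), FULL when `φ ≠ 𝟙` (Rem. 33,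
first sentence); (K3) [Kri16] Thm. 3 / Prop. 37 (weight `k`, printed) and the `q`-expansion principle;
(CH) the measure `𝓛_v(g) ∈ Λ_𝒪^{ur}` of [KY24] Prop. 2.1.1 (Castella–Hsieh §3.3) and [CGLS]'s
(2.13)/(eq:cor-37)/(eq:cor-meas) RE-READ AT WEIGHT `k` ("as in [CGLS]", [KY24] Thm. 2.2.1) ⟹
`𝓛_g ≡ (𝓔^ι_{φ,ψ})²·(𝓛^{(k)}_φ)² (mod pΛ^{ur})`; for `φ = 𝟙` with only partial descent the DEPLETION
JOIN `g^♭ ≡ G^♭` ([KY24] Thm. 2.2.1's remark = [Kri16] §4.3 ¶1) — at the member's weight `k ≥ 2p` Rem. 33's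
θ-injectivity `p > k + 1` NEVER holds, so this preprint step is load-bearing whenever `E[p]^{ss} = 𝟙 ⊕ ω`
(hence the `_OPEN` tag of §§1–2; §3 excludes it by `φ ≠ 𝟙`); (H) Hida 2010: `μ(𝓛_φ) = 0` (the conductor
of `φ_K` is divisible only by primes split in `K`, by (Heeg)) — [KY24] use it for their weight-`k` Katz
line (branch character `φ_K𝐍^{k/2}`); under the parity clause of §§2–3 that line is the weight-`2` one
mod `p` (rider (d′)), without it (§1, `(k−2)/(p−1)` odd) it is the quadratic-twisted branch — part of the
preprint reading of §1; `μ` of every Euler factor `𝒫_w(·)` at a split `w` is `0`; (Σ) `λ(𝓛^Σ_g) = λ(𝓛_g) + Σ_{w∈Σ} λ𝒫_w(g)` and [CGLS] (eq:Euler-comp) with [Kri16]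
Thm. 34 (3)'s congruences at `ℓ ∣ M` (`a_ℓ ≡ φ(ℓ)` on `M₊`, `≡ φ^{−1}(ℓ)ℓ^{k−1} ≡ ψ(ℓ)` on `M₋`, `a_ℓ = 0`
on `M₀`) ⟹ `λ(𝓛^Σ_g) = 2λ(𝓛^{(k)}_φ) + Σ_{w∈Σ}(λ𝒫_w(φ) + λ𝒫_w(ψ))` (both conjugates `w, w̄ ∣ ℓ`
counted, "where `w` runs over all divisors"); (d′) THE PARITY CLAUSE `2(p − 1) ∣ k − 2` (a binder of
§§2–3, as in the registered stub): it makes `ℓ^{(k−2)/2} ≡ 1 (mod p)`, so the weight-`k` central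
normalisations `a_ℓ ℓ^{−k/2}` of the Σ-Euler factors reduce to the weight-`2` ones `a_ℓ ℓ^{−1}` WITHOUT
the quadratic character `(ℓ/p)`, and it makes [KY24] Thm. 2.1.3's weight-`k` Katz element `𝓛^{(k)}_φ`
(values `L(θ_K χ 𝐍_K^{k/2}, 0)`) CONGRUENT mod `pΛ^{ur}` to the weight-`2` element of the tree's frame
`IsKatzLFunction` (twist of the Katz measure by `𝐍^{(k−2)/2} = ω^{(p−1)m}⟨𝐍⟩^{(p−1)m} ≡ 1`), hence with
the SAME first unit index `nφ` — a one-line filer's step, not printed; (a′) [Kri16]'s level hypothesis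
`N > 4` reads `4 < N/p` for the member and is NOT a binder (as in the weight-`2` sibling and in [CGLS]'s
own citation of [Kri16]; vacuous in nature on the crux's cell X2c: analytic rank `1` forces `N ≥ 37`, a multiplicative Eisenstein
prime is `≤ 13`, and `N/p ≤ 4` would need `N ≤ 52`, i.e. `N ∈ {37, 43}` prime with `p = N` irreducible;
[LZZ18] removes it); (per) each frame carries its own period binders (`ΩK', Ωp'` resp. `ΩK″, Ωp″`): in `μ/λ`
currency the unit renormalisations ([CGLS] vs Castella constants, `Ω_∞ = 2πi·Ω_K`, [KY24] Rem. 2.1.2)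
are immaterial — "(β)" of the sibling's module docstring; (CHp) [CastellaHsieh2018]'s standing
`p ∤ (2r − 1)!` fails for every member (`k ≥ 2p`): [KY24] Prop. 2.1.1 "can be directly removed" (the
analytic construction via Serre–Tate expansions of the depleted form needs no such bound) — part of the
preprint reading.

## What is NOT here

* The measure congruence [KY24]/[CGLS] Thm. 2.2.1 itself (needs Euler elements `𝒫_w(θ) ∈ Λ` and a
  CGLS-normalised twin frame; "(α)" of the sibling) — only its `μ/λ` consequence is typed.
* The existence of the member and of its frame (crux 4's `stub_crystallineFibre` (I); Hida 1986 Thm. I;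
  Castella JIMJ 2020 Thm. 1.4 (i)) and of the Katz frame ([CGLS] Thm. 2.1.2 = tree
  `thm212_exists_isKatzLFunction`): the statements below quantify UNIVERSALLY over members and frames.
* Any proof, any bridge. The crux's helper `Theorems/EisensteinPrimesBSDpOnCellCMemberInvariantsOfAnacongWt.lean`
  derives the registered `stub_memberInvariants` (i) ∧ (ii′) from §1 ∧ §2 by instantiation and index
  uniqueness, and proves the bookkeeping bridge §2 ⟹ §3 (`--supports stmt-BirchSwinnertonDyer-19034`);
  this file is statements only.

## References
* [KellerYin2024] T. Keller, M. Yin, arXiv:2402.12781v2, §2 (p. 18): Prop. 2.1.1, Rem. 2.1.2, Thm. 2.1.3,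
  Thm. 2.2.1 (with the partial-descent remark), Thm. 2.2.2; Lemma 1.1.1.
* [CastellaGrossiLeeSkinner2022] Invent. Math. 227 (2022), Thm. 2.2.1 (`thm:kriz`) and Thm. 2.2.2
  (`cor:Kriz`) with their proofs ((2.13), (eq:cor-37), (eq:cor-meas), (eq:Euler-comp), (2.16)); Thm. 2.1.2.
* [Kriz2016] D. Kriz, Algebra Number Theory 10 (2016) 309–374 (arXiv:1512.05032): Assumptions 1, Thm. 3,
  §4.3, Def. 31, Rem. 32–33, Thm. 34, Thm. 35, Prop. 37, Thm. 27.
* [Hida2010MuInvariant] H. Hida, Ann. of Math. 172 (2010), Thm. I. [CastellaHsieh2018] Math. Ann. 370, §3.3.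
* [Skinner2016PacificMC] §2.6, §3.1 (a) (the member). [JetchevSkinnerWan2017] §5.1 (`L^Σ_p`).
* [Washington1997] §7.1 (first unit coefficient = `μ = 0 ∧ λ = n`).
-/

noncomputable section

open scoped Classical

open WeierstrassCurve NumberField IsDedekindDomain Field Polynomial
  Literature.NumberTheory.EllipticCurves Literature.NumberTheory.EllipticCurves.ModularForms
  Literature.NumberTheory.QuadraticFields Literature.NumberTheory.EllipticCurves.Rank1Residual
  Literature.NumberTheory.EllipticCurves.Castella2018 Literature.NumberTheory.EllipticCurves.GreenbergSelmer
  Literature.NumberTheory.EllipticCurves.GreenbergVatsal2000 Literature.NumberTheory.GaloisRepresentations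
  Literature.NumberTheory.EllipticCurves.CastellaGrossiLeeSkinner2022

namespace Literature.NumberTheory.EllipticCurves.KellerYin2024

/-! ## §1 `μ(𝓛^Σ_𝔭(g)) = 0` for the crystalline member — [KY24] Thm. 2.2.2, first clause, at weight `k`
(PREPRINT-tagged: load-bearing for `E[p]^{ss} = 𝟙 ⊕ ω` through the depletion join) -/

/-- **Keller–Yin, arXiv:2402.12781v2, Thm. 2.2.2 (`anacong`), FIRST CLAUSE «`μ(𝓛_f) = 0`», at weight
`k = 2r` (§2 standing, p. 18: "`f ∈ S_k(Γ₀(N))` with `k = 2r` a newform, `p ∤ 2N`, `K` … Heegner …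
`p = v v̄` split … `D_K` odd, `D_K ≠ −3`"; "Assume that `ρ̄_f^{ss} = 𝔽(φ) ⊕ 𝔽(ψ)` … Then `μ(𝓛_f) = 0`"),
for `f :=` the crystalline Hida MEMBER `g = D.g ∈ S_k(Γ₀(N/p))` of an elliptic curve `E/ℚ` at an odd
multiplicative Eisenstein prime `p ∥ N` (module docstring "The object": `g` is a `p`-ordinary newform of
even weight `k > 2` and level `N/p` prime to `p`, and `ρ̄_g^{ss} ≅ E[p]^{ss}` is reducible — rider (BN)),
read on EVERY Σ-imprimitive weight-`k` frame `Qg ∈ 𝓞_{ℂ_p}⟦T⟧` of `g` (`IsBDPLFunctionWtSigmaInt`, [KY24]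
Prop. 2.1.1's constants, Σ = the places of `K` dividing `N/p`): `Qg` HAS A FIRST UNIT COEFFICIENT
(`‖[Tⁿ]Qg‖ = 1`, `‖[Tⁱ]Qg‖ < 1` for `i < n` — "`μ = 0`", Washington §7.1; the Σ-Euler factors at the split
places of Σ have `μ = 0`, rider (Σ)). PRINTED ARGUMENT ("as in [CGLS]"): [Kri16] Thm. 34 (3) ⟹ partial
Eisenstein descent at weight `k` ⟹ [KY24]/[CGLS] Thm. 2.2.1 `𝓛_g ≡ (𝓔^ι_{φ,ψ})²(𝓛_φ)² (mod pΛ^{ur})`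
([Kri16] Thm. 3 / Prop. 37 at weight `k`, Castella–Hsieh's measure, (eq:cor-37), (eq:cor-meas)) ⟹
`μ = 0` by Hida 2010 (`μ(𝓛_φ) = 0`: `cond φ_K` is a product of split primes by (Heeg)). UNREFEREED
PREPRINT CLAIM as stated (`_OPEN`): for `E[p]^{ss} = 𝟙 ⊕ ω` (`φ = 𝟙`) the member (weight `k ≥ 2p`) may
have only PARTIAL descent ([Kri16] Rem. 33 needs `p > k + 1` for fullness) and the congruence of measures
then rests on the depletion join of [KY24] Thm. 2.2.1's proof remark ([Kri16] §4.3 ¶1); riders (BN),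
(CH), (CHp), (a′) `4 < N/p` not a binder, (per) — module docstring. Binders = those of the crux's
registered `stub_memberInvariants.1` (crux 4 `BSDpOnCellC`, line «crystal») with `CellC` unfolded to
`2 < p`, `Red`, multiplicative. Named statement (D-0014): nothing about any curve or form is asserted;
NEVER cite this `Prop` as a theorem. [claim: KellerYin2024, status: under-review]
[cite: KellerYin2024, Thm. 2.2.2 (anacong) first clause, §2 standing, Prop. 2.1.1, Thm. 2.2.1 with its remark (arXiv:2402.12781v2 p. 18)]
[cite: CastellaGrossiLeeSkinner2022, Thm. 2.2.1 (thm:kriz) and Thm. 2.2.2 (cor:Kriz) with proofs ((2.13), (eq:cor-37), (eq:cor-meas)) (arXiv:2008.02571 p. 12)]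
[cite: Kriz2016, Thm. 3 and §4.3, Thm. 34 (3), Rem. 33, Prop. 37 (Algebra Number Theory 10 (2016); arXiv:1512.05032 pp. 8, 20–22, 27–28)]
[cite: Hida2010MuInvariant, Thm. I] [cite: Skinner2016PacificMC, §2.6 and §3.1 (a) (the member)]
[cite: JetchevSkinnerWan2017, §5.1 (Σ-imprimitive L-function)] [cite: Washington1997, §7.1] -/
def thm222_anacong_hidaMember_sigma_mu_OPEN : Prop :=
  ∀ (W : WeierstrassCurve ℚ) [W.IsElliptic] [W.IsGloballyMinimal] (p : ℕ) [Fact p.Prime],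
    2 < p → Red W p → W.HasMultiplicativeReductionAtPrime p →
    ∀ (N : ℕ) [NeZero N] (K : Type) [Field K] [NumberField K],
      W.conductorNorm ℤ = N →
      IsImaginaryQuadratic K → NumberField.discr K < -4 → SatisfiesHeegnerHypothesis N K →
      Odd (NumberField.discr K) →
      ∀ (κ : ZpExtension K p), κ.IsAnticyclotomic →
        ∀ (γ : Field.absoluteGaloisGroup K) [Fact (κ.IsTopGenerator γ)]
          (𝔭 : HeightOneSpectrum (𝓞 K)), ((p : ℕ) : 𝓞 K) ∈ 𝔭.asIdeal →
            ((Ideal.span {(p : ℤ)}).primesOver (𝓞 K)).ncard = 2 →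
          ∀ (ι' : PadicAlgCl p ≃+* ℂ),
            (∀ (w : InfinitePlace K) (k : 𝓞 K),
              k ∈ 𝔭.asIdeal ↔ ‖ι'.symm (w.embedding (k : K))‖ < 1) →
            ∀ (D : Skinner2016.HidaCongruentForm W p 1), (∀ x : coeffField D.g, ι' (D.ι x) = (x : ℂ)) →
              ∀ (ΩK' : ℂ) (Ωp' : ℂ_[p]) (Qg : PowerSeries 𝓞_ℂ_[p]), ΩK' ≠ 0 → ‖Ωp'‖ = 1 →
                IsBDPLFunctionWtSigmaInt ι' 𝔭 κ γ D.g (W.sigmaPlacesFinset p K) ΩK' Ωp' Qg →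
                  ∃ n : ℕ, ‖((PowerSeries.coeff n Qg : 𝓞_ℂ_[p]) : ℂ_[p])‖ = 1 ∧
                    ∀ i < n, ‖((PowerSeries.coeff i Qg : 𝓞_ℂ_[p]) : ℂ_[p])‖ < 1

/-! ## §2 The `λ`-count at the crystalline member — [KY24] Thm. 2.2.2, second clause, at weight `k`,
Σ-imprimitive, `(𝓛_φ)²` read as `2·nφ` (PREPRINT-tagged, as §1) -/

/-- **Keller–Yin, arXiv:2402.12781v2, Thm. 2.2.2 (`anacong`) at weight `k = 2r` — BOTH clauses:
«Assume that `ρ̄_f^{ss} = 𝔽(φ) ⊕ 𝔽(ψ)` as `G_ℚ`-modules, with the characters `φ`, `ψ` labeled so that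
`p ∤ cond(φ)`. Then `μ(𝓛_f) = 0` and `λ(𝓛_f) = λ(𝓛_φ) + λ(𝓛_ψ) + Σ_{w∈S}{λ(𝒫_w(φ)) + λ(𝒫_w(ψ)) −
λ(𝒫_w(f))}`» — for `f :=` the crystalline Hida member `g = D.g ∈ S_k(Γ₀(N/p))` of `E/ℚ` at an odd
multiplicative Eisenstein prime `p ∥ N`, read Σ-IMPRIMITIVELY on every frame `Qg` of
`𝓛^Σ_𝔭(g) = 𝓛_𝔭(g)·∏_{w∈Σ}𝒫_w(g)` (Σ = places of `K` over `N/p`), with `(𝓛_φ)²` of Thm. 2.2.1 read as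
`2·λ(𝓛_φ)` (no functional equation, no Katz frame for the `p`-ramified `ψ`) and `λ(𝒫_w(θ))` = the
tree's `charLocalLambda` ([KY24] Lemma 1.1.1).** Transcription (module docstring "The object"): `W, p`
(`2 < p`, multiplicative), `N = N_W`, `K` imaginary quadratic with (Heeg) for `N`, `D_K` odd `< −4`, `κ`
anticyclotomic, `γ`, `𝔭 ∣ p` of degree one with conjugate `𝔭bar ≠ 𝔭`, `p` split, `ι'` inducing `𝔭`;
the member `D : Skinner2016.HidaCongruentForm W p 1` with `ι' ∘ D.ι = id` AND THE PARITY CLAUSE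
`2(p − 1) ∣ k − 2` (rider (d′): it identifies the weight-`k` normalisations — Σ-Euler factors
`a_ℓ ℓ^{−k/2}` and [KY24] Thm. 2.1.3's `𝐍^{k/2}`-shifted Katz line — with the weight-`2` ones mod `p`);
a Σ-frame `(ΩKg ≠ 0, ‖Ωpg‖ = 1, Qg)` with `IsBDPLFunctionWtSigmaInt ι' 𝔭 κ γ D.g (W.sigmaPlacesFinset p K)
ΩKg Ωpg Qg`; a rational `p`-line `Φ` of `E[p]` with its Teichmüller pair `(θsub, θquot)` over `𝒪 = ℤ_p`,
`{φ, ψ} = {θsub, θquot}` with `φ` UNRAMIFIED above `p` ("`p ∤ cond(φ)`"); `θK` the Hecke character of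
`φ|_{G_K}` (`IsHeckeCharOf`, arithmetic convention), `Cbar` a finite set of places where `θK` is ramified,
and a Katz frame `(ΩK' ≠ 0, Ωp' ∈ R₀ˣ, Lφ)` with `IsKatzLFunction ι' 𝔭 𝔭bar Cbar κ γ θK ΩK' Ωp' Lφ`
([CGLS] Thm. 2.1.2's weight-`2` line). CONCLUSION: there are `n nφ : ℕ` with `‖[Tⁿ]Qg‖ = 1`,
`‖[Tⁱ]Qg‖ < 1 (i < n)` ("`μ(𝓛^Σ_g) = 0`, `λ = n`"), `FirstUnitCoeffAt Lφ nφ` (Hida 2010) and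
`n = 2·nφ + Σ_{w ∈ Σ(W,p)(K)} (λ𝒫_w(θsub) + λ𝒫_w(θquot))` — the printed identity with `S = Σ` after the
Σ-imprimitive bookkeeping `λ(𝓛^Σ_g) = λ(𝓛_g) + Σ_{w∈Σ}λ𝒫_w(g)` and [CGLS] (eq:Euler-comp) (rider (Σ)).
PRINTED ARGUMENT and RIDERS (BN), (K34), (K3), (CH), (CHp), (H), (Σ), (d′), (a′) `4 < N/p` not a binder,
(per): module docstring. UNREFEREED PREPRINT CLAIM as stated (`_OPEN`): covers `φ = 𝟙` (`E[p]^{ss} =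
𝟙 ⊕ ω`), where the member of weight `k ≥ 2p` may have only partial Eisenstein descent and the measure
congruence uses the depletion join ([KY24] Thm. 2.2.1's remark); on `φ ≠ 𝟙` it is §3
(`thm222_anacong_hidaMember_sigma_lambda_of_ne_one`, which it implies). Binders = those of the crux's registered
`stub_memberInvariants.2` (crux 4 `BSDpOnCellC`, line «crystal»; `CellC` unfolded); its inequality
`n ≤ 2·nφ + ΣΣ` follows from this equality by uniqueness of the first unit index. Named statement
(D-0014): nothing about any curve or form is asserted; NEVER cite this `Prop` as a theorem.
[claim: KellerYin2024, status: under-review]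
[cite: KellerYin2024, Thm. 2.2.2 (anacong), Thm. 2.2.1 with its remark, Thm. 2.1.3, Prop. 2.1.1, Rem. 2.1.2, Lemma 1.1.1 (arXiv:2402.12781v2 pp. 9, 18)]
[cite: CastellaGrossiLeeSkinner2022, Thm. 2.2.1 and Thm. 2.2.2 with proofs ((2.13), (eq:cor-37), (eq:cor-meas), (eq:Euler-comp)); Thm. 2.1.2 (arXiv:2008.02571 pp. 11–12)]
[cite: Kriz2016, Thm. 3 and §4.3, Thm. 34 (1)–(3), Rem. 33, Prop. 37, Thm. 27 (Algebra Number Theory 10 (2016); arXiv:1512.05032 pp. 8, 18, 20–22, 27–28)]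
[cite: Hida2010MuInvariant, Thm. I] [cite: Skinner2016PacificMC, §2.6 and §3.1 (a)] [cite: JetchevSkinnerWan2017, §5.1]
[cite: Washington1997, §7.1 Prop. 7.2] -/
def thm222_anacong_hidaMember_sigma_lambda_OPEN : Prop :=
  ∀ (W : WeierstrassCurve ℚ) [W.IsElliptic] [W.IsGloballyMinimal] (p : ℕ) [Fact p.Prime],
    2 < p → W.HasMultiplicativeReductionAtPrime p →
    ∀ (N : ℕ) [NeZero N] (K : Type) [Field K] [NumberField K],
      W.conductorNorm ℤ = N →
      IsImaginaryQuadratic K → NumberField.discr K < -4 → SatisfiesHeegnerHypothesis N K →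
      Odd (NumberField.discr K) →
      ∀ (κ : ZpExtension K p), κ.IsAnticyclotomic →
        ∀ (γ : Field.absoluteGaloisGroup K) [Fact (κ.IsTopGenerator γ)]
          (𝔭 : HeightOneSpectrum (𝓞 K)), ((p : ℕ) : 𝓞 K) ∈ 𝔭.asIdeal →
          𝔭.asIdeal.ramificationIdx (𝓞 ℚ) = 1 → 𝔭.asIdeal.inertiaDeg (𝓞 ℚ) = 1 →
          ∀ (𝔭bar : HeightOneSpectrum (𝓞 K)), ((p : ℕ) : 𝓞 K) ∈ 𝔭bar.asIdeal → 𝔭bar ≠ 𝔭 →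
            ((Ideal.span {(p : ℤ)}).primesOver (𝓞 K)).ncard = 2 →
          ∀ (ι' : PadicAlgCl p ≃+* ℂ),
            (∀ (w : InfinitePlace K) (k : 𝓞 K),
              k ∈ 𝔭.asIdeal ↔ ‖ι'.symm (w.embedding (k : K))‖ < 1) →
            ∀ (D : Skinner2016.HidaCongruentForm W p 1), (∀ x : coeffField D.g, ι' (D.ι x) = (x : ℂ)) →
              2 * ((p : ℤ) - 1) ∣ D.k - 2 →
              ∀ (ΩKg : ℂ) (Ωpg : ℂ_[p]) (Qg : PowerSeries 𝓞_ℂ_[p]), ΩKg ≠ 0 → ‖Ωpg‖ = 1 →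
                IsBDPLFunctionWtSigmaInt ι' 𝔭 κ γ D.g (W.sigmaPlacesFinset p K) ΩKg Ωpg Qg →
                ∀ (Φ : AddSubgroup (geomTorsion W (p : ℤ))), IsRationalLine W p Φ →
                ∀ (θsub θquot : FramedGaloisRep ℚ (padicCoeffIntegers (∅ : Set (PadicAlgCl p))) 1),
                  IsTeichmullerLiftOn (∅ : Set (PadicAlgCl p)) (Φ.map (geomTorsion W (p : ℤ)).subtype) θsub →
                  IsTeichmullerLiftOnQuot (∅ : Set (PadicAlgCl p)) (Φ.map (geomTorsion W (p : ℤ)).subtype)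
                    (geomTorsion W (p : ℤ)) θquot →
                ∀ (φ ψ : FramedGaloisRep ℚ (padicCoeffIntegers (∅ : Set (PadicAlgCl p))) 1),
                  (φ = θsub ∧ ψ = θquot ∨ φ = θquot ∧ ψ = θsub) →
                  (∀ u : HeightOneSpectrum (𝓞 ℚ), ((p : ℕ) : 𝓞 ℚ) ∈ u.asIdeal → φ.IsUnramifiedAt u) →
                ∀ (θK : HeckeCharacter K), IsHeckeCharOf ι' (φ.restrictField K) θK →
                ∀ (Cbar : Finset (HeightOneSpectrum (𝓞 K))), (∀ u ∈ Cbar, ¬ θK.IsUnramifiedAt u) →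
                ∀ (ΩK' : ℂ) (Ωp' : (unrIntegers p)ˣ) (Lφ : UnrSeries p), ΩK' ≠ 0 →
                  IsKatzLFunction ι' 𝔭 𝔭bar Cbar κ γ θK ΩK' ((Ωp' : unrIntegers p) : ℂ_[p]) Lφ →
                ∃ n nφ : ℕ,
                  (‖((PowerSeries.coeff n Qg : 𝓞_ℂ_[p]) : ℂ_[p])‖ = 1 ∧
                    ∀ i < n, ‖((PowerSeries.coeff i Qg : 𝓞_ℂ_[p]) : ℂ_[p])‖ < 1) ∧
                  FirstUnitCoeffAt Lφ nφ ∧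
                  n = 2 * nφ + ∑ w ∈ W.sigmaPlacesFinset p K,
                    (charLocalLambda (∅ : Set (PadicAlgCl p)) κ (θsub.restrictField K) w +
                      charLocalLambda (∅ : Set (PadicAlgCl p)) κ (θquot.restrictField K) w)

/-! ## §3 The same on `φ ≠ 𝟙` — FULL Eisenstein descent ([Kri16] Rem. 33), so [CGLS]'s proof of
Thms. 2.2.1–2.2.2 runs verbatim at weight `k` over [Kri16] Thm. 3 / Thm. 34 / Prop. 37 and Castella–Hsieh:
a COMPOSITION OF REFEREED PRINT (label: the referee's) -/

/-- **[CGLS] Thms. 2.2.1–2.2.2 (Invent. Math. 227 (2022)) re-run at weight `k = 2r` over [Kri16] Thm. 3 /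
Thm. 34 / Rem. 33 / Prop. 37 (Algebra Number Theory 10 (2016), all stated for weight `k ≥ 2`),
Castella–Hsieh §3.3 and Hida 2010 — the statement `thm222_anacong_hidaMember_sigma_lambda_OPEN` WITH THE
EXTRA HYPOTHESIS «`φ ≠ 𝟙`» (`¬ ∀ σ : Γ_ℚ, φ σ = 1`, [CGLS] Thm. 2.2.2's printed "suppose `φ ≠ 𝟙`"), under
which the member has FULL Eisenstein descent ([Kri16] Rem. 33, first sentence: "If `ψ₁` is non-trivial,
then … (5) holds", `ψ₁ = φ`), so that [CGLS]'s (eq:cong-mf) `g ≡ G (mod 𝔪)` holds as printed and no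
depletion join is used; stated as [KY24] Thm. 2.2.2 states it ("the cases … `φ|_{G_K} ≠ 𝟙` … are already
studied in [CGLS]").** Everything else — object, dictionary, conclusion — VERBATIM §2. A COMPOSITION OF
REFEREED PRINT in the sense of the weight-`2` `thm222_anacong_goodLattice_of_five_le` (riders a referee
must check, module docstring: (BN) Brauer–Nesbitt for the member, (K34), (K3), (CH) [CGLS]'s
(2.13)/(eq:cor-37)/(eq:cor-meas) re-read at weight `k`, (CHp), (H), (Σ), (d′) parity ⟹ weight-`k` ≡
weight-`2` Katz line mod `p`, (a′) `4 < N/p` not a binder, (per)); its LABEL (composed-PUB vs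
preprint-grade display) is the referee's / director's (ruling (318)(1)), not the filer's. Bridge §2 ⟹ §3 (bookkeeping):
proved in the crux's helper file, not here (statements only). Named statement (D-0014): nothing about any curve
or form is asserted. [cite: CastellaGrossiLeeSkinner2022, Thm. 2.2.1 (thm:kriz) and Thm. 2.2.2 (cor:Kriz) with proofs ((eq:cong-mf), (2.13), (eq:cor-37), (eq:cor-meas), (eq:Euler-comp)); Thm. 2.1.2 (arXiv:2008.02571 pp. 11–12)]
[cite: Kriz2016, Thm. 3 and §4.3, Def. 31, Rem. 33 (first sentence), Thm. 34 (1)–(3), Prop. 37, Thm. 27 (Algebra Number Theory 10 (2016); arXiv:1512.05032 pp. 8, 18, 20–22, 27–28)]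
[cite: KellerYin2024, §2 standing, Prop. 2.1.1, Thm. 2.1.3, Thm. 2.2.1, Thm. 2.2.2 (arXiv:2402.12781v2 p. 18) (the weight-k statement)]
[cite: CastellaHsieh2018, §3.3 Def. 3.7 and Prop. 3.8 (the weight-k measure)] [cite: Hida2010MuInvariant, Thm. I]
[cite: Skinner2016PacificMC, §2.6 and §3.1 (a)] [cite: JetchevSkinnerWan2017, §5.1] [cite: Washington1997, §7.1 Prop. 7.2] -/
def thm222_anacong_hidaMember_sigma_lambda_of_ne_one : Prop :=
  ∀ (W : WeierstrassCurve ℚ) [W.IsElliptic] [W.IsGloballyMinimal] (p : ℕ) [Fact p.Prime],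
    2 < p → W.HasMultiplicativeReductionAtPrime p →
    ∀ (N : ℕ) [NeZero N] (K : Type) [Field K] [NumberField K],
      W.conductorNorm ℤ = N →
      IsImaginaryQuadratic K → NumberField.discr K < -4 → SatisfiesHeegnerHypothesis N K →
      Odd (NumberField.discr K) →
      ∀ (κ : ZpExtension K p), κ.IsAnticyclotomic →
        ∀ (γ : Field.absoluteGaloisGroup K) [Fact (κ.IsTopGenerator γ)]
          (𝔭 : HeightOneSpectrum (𝓞 K)), ((p : ℕ) : 𝓞 K) ∈ 𝔭.asIdeal →
          𝔭.asIdeal.ramificationIdx (𝓞 ℚ) = 1 → 𝔭.asIdeal.inertiaDeg (𝓞 ℚ) = 1 →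
          ∀ (𝔭bar : HeightOneSpectrum (𝓞 K)), ((p : ℕ) : 𝓞 K) ∈ 𝔭bar.asIdeal → 𝔭bar ≠ 𝔭 →
            ((Ideal.span {(p : ℤ)}).primesOver (𝓞 K)).ncard = 2 →
          ∀ (ι' : PadicAlgCl p ≃+* ℂ),
            (∀ (w : InfinitePlace K) (k : 𝓞 K),
              k ∈ 𝔭.asIdeal ↔ ‖ι'.symm (w.embedding (k : K))‖ < 1) →
            ∀ (D : Skinner2016.HidaCongruentForm W p 1), (∀ x : coeffField D.g, ι' (D.ι x) = (x : ℂ)) →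
              2 * ((p : ℤ) - 1) ∣ D.k - 2 →
              ∀ (ΩKg : ℂ) (Ωpg : ℂ_[p]) (Qg : PowerSeries 𝓞_ℂ_[p]), ΩKg ≠ 0 → ‖Ωpg‖ = 1 →
                IsBDPLFunctionWtSigmaInt ι' 𝔭 κ γ D.g (W.sigmaPlacesFinset p K) ΩKg Ωpg Qg →
                ∀ (Φ : AddSubgroup (geomTorsion W (p : ℤ))), IsRationalLine W p Φ →
                ∀ (θsub θquot : FramedGaloisRep ℚ (padicCoeffIntegers (∅ : Set (PadicAlgCl p))) 1),
                  IsTeichmullerLiftOn (∅ : Set (PadicAlgCl p)) (Φ.map (geomTorsion W (p : ℤ)).subtype) θsub →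
                  IsTeichmullerLiftOnQuot (∅ : Set (PadicAlgCl p)) (Φ.map (geomTorsion W (p : ℤ)).subtype)
                    (geomTorsion W (p : ℤ)) θquot →
                ∀ (φ ψ : FramedGaloisRep ℚ (padicCoeffIntegers (∅ : Set (PadicAlgCl p))) 1),
                  (φ = θsub ∧ ψ = θquot ∨ φ = θquot ∧ ψ = θsub) →
                  (∀ u : HeightOneSpectrum (𝓞 ℚ), ((p : ℕ) : 𝓞 ℚ) ∈ u.asIdeal → φ.IsUnramifiedAt u) →
                  (¬ ∀ σ : Field.absoluteGaloisGroup ℚ, φ σ = 1) →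
                ∀ (θK : HeckeCharacter K), IsHeckeCharOf ι' (φ.restrictField K) θK →
                ∀ (Cbar : Finset (HeightOneSpectrum (𝓞 K))), (∀ u ∈ Cbar, ¬ θK.IsUnramifiedAt u) →
                ∀ (ΩK' : ℂ) (Ωp' : (unrIntegers p)ˣ) (Lφ : UnrSeries p), ΩK' ≠ 0 →
                  IsKatzLFunction ι' 𝔭 𝔭bar Cbar κ γ θK ΩK' ((Ωp' : unrIntegers p) : ℂ_[p]) Lφ →
                ∃ n nφ : ℕ,
                  (‖((PowerSeries.coeff n Qg : 𝓞_ℂ_[p]) : ℂ_[p])‖ = 1 ∧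
                    ∀ i < n, ‖((PowerSeries.coeff i Qg : 𝓞_ℂ_[p]) : ℂ_[p])‖ < 1) ∧
                  FirstUnitCoeffAt Lφ nφ ∧
                  n = 2 * nφ + ∑ w ∈ W.sigmaPlacesFinset p K,
                    (charLocalLambda (∅ : Set (PadicAlgCl p)) κ (θsub.restrictField K) w +
                      charLocalLambda (∅ : Set (PadicAlgCl p)) κ (θquot.restrictField K) w)

end Literature.NumberTheory.EllipticCurves.KellerYin2024

end
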